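import Mathlib
import Summits.Ventures.PercRepro2.K5Conn
import Summits.Ventures.PercRepro2.K5TypedK3Marks
import Summits.Ventures.PercRepro2.PMPendantBeta

/-!
# THE SIX-VERTEX FAMILY `K₅ + a₃ PENDANT AT a₂`: the graph `ends6r` and the transfer of probabilities and
connections to the `K₅` base (blind cell PercRepro2, mine-2 g24; the `a₂`-attachment twin of `PMK5Pendant.lean`)

`ends6r : Fin 11 → Sym2 (Fin 6)` is `K₅` on the marks `o = 0, a₁ = 1, a₂ = 2, u = 3, b = 4` (the ten edges of
`K5.ends5`, vertices embedded by `Fin.castSucc`) plus the pendant edge `10 = {2, 5}` to the leaf `a₃ = 5` at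
`a₂`.  Every simple graph on the six vertices in which `a₃` is a leaf at `a₂` is `ends6r` with zero weights.
**The transfer** (`prob_resr`, `connEvent6r_eq`): restricting a configuration to the ten `K₅` edges maps the
product measure to the product measure (the pendant weight sums out), and a connection among the first five
vertices is the same connection in `ends5` (the leaf is a dead end) — word for word the proofs of
`PMK5Pendant.lean` with the attachment vertex `2` in place of `3`.  Used by `PMK5LocusPendantRoot.lean` (Theorem 22).
-/

namespace Summit.Ventures.PercRepro2

open CovForm

namespace K5

namespace PendR

/-! ## The graph -/

/-- `K₅` on `0, …, 4` plus the pendant edge `{2, 5}` (edge `10`): `a₃ = 5` a leaf at `a₂ = 2`. -/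
def ends6r : Fin 11 → Sym2 (Fin 6) :=
  Fin.snoc (α := fun _ => Sym2 (Fin 6)) (fun e => (ends5 e).map Fin.castSucc) s(2, 5)

/-- The ten `K₅` edges of `ends6r`. -/
lemma ends6r_castSucc (e : Fin 10) : ends6r (Fin.castSucc e) = (ends5 e).map Fin.castSucc := by
  simp [ends6r]

/-- The pendant edge of `ends6r`. -/
lemma ends6r_last : ends6r (Fin.last 10) = s(2, 5) :=
  Fin.snoc_last _ _

/-- The restriction of a configuration of `ends6r` to the ten `K₅` edges. -/
def resr (ω : Config (Fin 11)) : Config (Fin 10) := fun e => ω (Fin.castSucc e)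

/-- `resr` of a `snoc` is the initial segment. -/
lemma resr_snoc (ω : Config (Fin 10)) (c : Bool) :
    resr (Fin.snoc (α := fun _ => Bool) ω c) = ω := by
  funext e; simp [resr]

/-- The leaf `5` is not an endpoint of a `K₅` edge. -/
lemma five_notMem_castSucc_r (e : Fin 10) : (5 : Fin 6) ∉ ends6r (Fin.castSucc e) := by
  rw [ends6r_castSucc, Sym2.mem_map]
  rintro ⟨v, _, hv⟩
  have := Fin.castSucc_lt_last v
  rw [hv] at this
  exact absurd this (by decide)

/-- `5` is a leaf of `ends6r`: its only edge is the pendant edge. -/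
lemma leaf_five_r : ∀ e, (5 : Fin 6) ∈ ends6r e → e = Fin.last 10 := by
  intro e he
  induction e using Fin.lastCases with
  | last => rfl
  | cast e => exact absurd he (five_notMem_castSucc_r e)

/-! ## The transfer of probabilities -/

section Prob

variable {R : Type*} [Field R]

/-- The weight of a `snoc` configuration factors. -/
lemma weight_snoc_r (p : Fin 11 → R) (ω : Config (Fin 10)) (c : Bool) :
    weight p (Fin.snoc (α := fun _ => Bool) ω c) =
      weight (p ∘ Fin.castSucc) ω * edgeFactor (p (Fin.last 10)) c := by
  unfold weight
  rw [Fin.prod_univ_castSucc, Fin.snoc_last]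
  simp only [Fin.snoc_castSucc, Function.comp_apply]

/-- **The transfer of probabilities**: the probability under `p` of the pull-back of an event of the ten
`K₅` edges is its probability under `p ∘ Fin.castSucc` (the pendant weight sums out). -/
theorem prob_resr (p : Fin 11 → R) (A : Set (Config (Fin 10))) :
    prob p (resr ⁻¹' A) = prob (p ∘ Fin.castSucc) A := by
  classical
  unfold prob
  conv_lhs => rw [← (Fin.snocEquiv fun _ => Bool).sum_comp]
  rw [Fintype.sum_prod_type]
  simp only [Fin.snocEquiv, Equiv.coe_fn_mk, Set.indicator_apply, Set.mem_preimage, resr_snoc,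
    weight_snoc_r]
  rw [Finset.sum_comm]
  refine Finset.sum_congr rfl fun ω _ => ?_
  by_cases h : ω ∈ A
  · simp only [h, if_true, ← Finset.mul_sum]
    have : ∑ c : Bool, edgeFactor (p (Fin.last 10)) c = (1 : R) := by
      rw [Fintype.sum_bool]; exact edgeFactor_true_add_false (p (Fin.last 10))
    rw [this, mul_one]
  · simp [h]

end Prob

/-! ## The transfer of connections -/

/-- A connection in `ends5` lifts to `ends6r`. -/
lemma conn6r_of_conn_resr {ω : Config (Fin 11)} {x y : Fin 5} (h : Conn ends5 (resr ω) x y) :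
    Conn ends6r ω (Fin.castSucc x) (Fin.castSucc y) := by
  let φ : openGraph ends5 (resr ω) →g openGraph ends6r ω :=
    ⟨Fin.castSucc, fun {a c} hac => by
      rw [openGraph_adj] at hac ⊢
      obtain ⟨hne, e, he, hends⟩ := hac
      exact ⟨(Fin.castSucc_injective 5).ne hne, Fin.castSucc e, he,
        by rw [ends6r_castSucc, hends, Sym2.map_mk]⟩⟩
  exact h.map φ

/-- A connection in `ends6r` between two vertices other than the leaf is a connection in `ends5`
(the closure argument: the leaf `5` is a dead end at `2`). -/
lemma conn_resr_of_conn6r {ω : Config (Fin 11)} {x y : Fin 5}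
    (h : Conn ends6r ω (Fin.castSucc x) (Fin.castSucc y)) : Conn ends5 (resr ω) x y := by
  let S : Set (Fin 6) := {v | (v = 5 ∧ Conn ends5 (resr ω) x 2) ∨
    ∃ w : Fin 5, v = Fin.castSucc w ∧ Conn ends5 (resr ω) x w}
  have h5 : ∀ w : Fin 5, Fin.castSucc w ≠ (5 : Fin 6) := fun w hw => by
    have := Fin.castSucc_lt_last w
    rw [hw] at this
    exact absurd this (by decide)
  have hS : ∀ a ∈ S, ∀ c, (openGraph ends6r ω).Adj a c → c ∈ S := by
    intro a ha c hac
    rw [openGraph_adj] at hac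
    obtain ⟨_, e, he, hends⟩ := hac
    induction e using Fin.lastCases with
    | last =>
      rw [ends6r_last, Sym2.eq_iff] at hends
      rcases hends with ⟨rfl, rfl⟩ | ⟨rfl, rfl⟩
      · -- `a = 2`, `c = 5`
        rcases ha with ⟨h35, _⟩ | ⟨w, hw, hxw⟩
        · exact absurd h35 (by decide)
        · have : w = 2 := Fin.castSucc_injective _ (hw.symm.trans (by decide))
          subst this
          exact Or.inl ⟨rfl, hxw⟩
      · -- `a = 5`, `c = 2`
        rcases ha with ⟨_, hx3⟩ | ⟨w, hw, _⟩
        · exact Or.inr ⟨2, by decide, hx3⟩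
        · exact absurd hw.symm (h5 w)
    | cast e =>
      rw [ends6r_castSucc] at hends
      induction hends5 : ends5 e using Sym2.ind with
      | h a' c' =>
        rw [hends5, Sym2.map_mk, Sym2.eq_iff] at hends
        have hadj : Conn ends5 (resr ω) a' c' :=
          conn_of_openAdj ⟨e, he, hends5⟩
        rcases hends with ⟨rfl, rfl⟩ | ⟨rfl, rfl⟩
        · rcases ha with ⟨h5', _⟩ | ⟨w, hw, hxw⟩
          · exact absurd h5' (h5 a')
          · have : w = a' := Fin.castSucc_injective _ hw.symm
            subst this
            exact Or.inr ⟨c', rfl, conn_trans hxw hadj⟩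
        · rcases ha with ⟨h5', _⟩ | ⟨w, hw, hxw⟩
          · exact absurd h5' (h5 c')
          · have : w = c' := Fin.castSucc_injective _ hw.symm
            subst this
            exact Or.inr ⟨a', rfl, conn_trans hxw (conn_symm hadj)⟩
  have hy : Fin.castSucc y ∈ S :=
    mem_of_conn_of_closed hS (Or.inr ⟨x, rfl, conn_refl _ _ _⟩) h
  rcases hy with ⟨h5', _⟩ | ⟨w, hw, hxw⟩
  · exact absurd h5' (h5 y)
  · have : w = y := Fin.castSucc_injective _ hw.symm
    subst this
    exact hxw

/-- **The transfer of connection events**: among the first five vertices, `ends6r`'s connection events are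
the pull-backs of `ends5`'s. -/
theorem connEvent6r_eq (x y : Fin 5) :
    connEvent ends6r (Fin.castSucc x) (Fin.castSucc y) = resr ⁻¹' connEvent ends5 x y := by
  ext ω
  exact ⟨conn_resr_of_conn6r, conn6r_of_conn_resr⟩

end PendR

end K5

end Summit.Ventures.PercRepro2
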